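import Summits.ResolutionOfSingularities.ResolutionOfSingularities.Theorems.PurelyInseparableDim4ResConeVertexTop
import Summits.ResolutionOfSingularities.ResolutionOfSingularities.Theorems.MarkedTransferCampaignW46TameDirectrix
import Mathlib.LinearAlgebra.Basis.VectorSpace
import Mathlib.LinearAlgebra.FiniteDimensional.Lemmas
import HarnessLib
import HarnessLib.Audit.Tags

/-!
# Purely inseparable four-folds — THE `e_G = 3` SLICE IS A POWER CONE: a form of degree `d < p` whose polar
# kernel has codimension `1` is `c · ℓ^d` (every prime)

[OURS · counted 0 · cell `res-dim4-pi` · seat res-dim4-p-12 g2 · K2(p) lane (desk WORD #66 (2)).]  Nothing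
here proves K2(p), `NoIsolatedTrap p p` or resolution of singularities in dimension ≥ 4 / characteristic `p`.

The idea cards (I-4-7 «CONFINEMENT & COEFFICIENT LEDGER», I-4-8) start from «on a constant-`(d, e_G = 3)` stretch
the residual cone is `g = c · ℓ^d`, Hasse vertex `{ℓ = 0}`».  This file proves that normal form from the polar
kernel alone, in the TAME range `d < p` (for `d ≥ p` it is false: `x^p + y^p`):
* `polarMap_eq_sum_C_mul`, `polarMap_pderiv_comm` (polars commute with partials; the tree's
  `CampaignW46.TameDirectrix.pderiv_dirDeriv`);
* `polarMap_eq_smul_pderiv` — if the polar map `w ↦ D_w g` kills the hyperplane `Σ ℓᵢ wᵢ = 0` (`ℓ_{i₀} ≠ 0`),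
  then `D_w g = (ℓ(w)/ℓ_{i₀}) · ∂_{i₀} g` for every `w`;
* **`eq_C_mul_pow_of_ker_le`** — induction on `d < p` with Euler's identity
  (`MvPolynomial.IsHomogeneous.sum_X_mul_pderiv`): such a form is `C c * (Σ C ℓᵢ · Xᵢ)^d`;
* **`resForm_eq_C_mul_pow_of_finrank_eq_three`** — for a state with `x^r ∣ F`, `ord₀ F = o`, shade
  `d = o − |r| < p` and `e_G = finrank (resVertex s) = 3`: `resForm s = C c * (Σ C ℓᵢ Xᵢ)^d` with `ℓ ≠ 0`
  vanishing on `resVertex s` (the kernel IS the hyperplane `{ℓ = 0}` by rank–nullity).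
bears_on: LADDER-RESOLUTION:D157-DOOR2 (res-dim4-pi · K2(p) · e_G = 3 slice).  Supports
stmt-ResolutionOfSingularities-16155 (helper).
-/

set_option linter.dupNamespace false -- mandated namespace of this single-conjunct summit

noncomputable section

namespace Summit.ResolutionOfSingularities.ResolutionOfSingularities.Theorems.PIDim4

namespace ResCone

open MvPolynomial Finset
open Literature.AlgebraicGeometry.Resolution
open Literature.AlgebraicGeometry.Resolution.CentreBlowup
open Literature.AlgebraicGeometry.Resolution.Hauser2010
open Literature.AlgebraicGeometry.Resolution.HauserPerlega2019
open PointBlowup (polarMap additiveSubspace direction)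

variable {K : Type} [Field K]

/-! ## 1. Polars commute with partials -/

/-- The polar as a `C`-linear combination of partials. [folklore] -/
theorem polarMap_eq_sum_C_mul (Φ : MvPolynomial (Fin 4) K) (w : Fin 4 → K) :
    polarMap Φ w = ∑ i, C (w i) * pderiv i Φ := by
  rw [NarrowApolarity.polarMap_apply]
  exact Finset.sum_congr rfl fun i _ => by rw [MvPolynomial.C_mul']

/-- **Polars commute with partials**: `D_w (∂_j Φ) = ∂_j (D_w Φ)`. [folklore] -/
theorem polarMap_pderiv_comm (Φ : MvPolynomial (Fin 4) K) (w : Fin 4 → K) (j : Fin 4) :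
    polarMap (pderiv j Φ) w = pderiv j (polarMap Φ w) := by
  rw [polarMap_eq_sum_C_mul, polarMap_eq_sum_C_mul, CampaignW46.TameDirectrix.pderiv_dirDeriv]

/-! ## 2. A polar map killing a hyperplane factors through the linear form -/

/-- **Factoring through the linear form**: if `D_w g = 0` whenever `Σ ℓᵢ wᵢ = 0` and `ℓ_{i₀} ≠ 0`, then
`D_w g = ((Σ ℓᵢ wᵢ) · ℓ_{i₀}⁻¹) • ∂_{i₀} g` for every `w`. [folklore] -/
theorem polarMap_eq_smul_pderiv {g : MvPolynomial (Fin 4) K} {ℓ : Fin 4 → K} {i₀ : Fin 4} (hi : ℓ i₀ ≠ 0)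
    (hker : ∀ w : Fin 4 → K, ∑ i, ℓ i * w i = 0 → polarMap g w = 0) (w : Fin 4 → K) :
    polarMap g w = ((∑ i, ℓ i * w i) * (ℓ i₀)⁻¹) • pderiv i₀ g := by
  set S := ∑ i, ℓ i * w i with hS
  have hw' : ∑ i, ℓ i * (w - (S * (ℓ i₀)⁻¹) • (Pi.single i₀ 1 : Fin 4 → K)) i = 0 := by
    have h2 : ∑ i, ℓ i * (S * (ℓ i₀)⁻¹ * (Pi.single i₀ 1 : Fin 4 → K) i) = S := by
      rw [Finset.sum_eq_single i₀ (fun i _ hi0 => by rw [Pi.single_eq_of_ne hi0, mul_zero, mul_zero])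
        (fun h => absurd (Finset.mem_univ _) h), Pi.single_eq_same, mul_one, mul_comm (ℓ i₀),
        inv_mul_cancel_right₀ hi]
    simp only [Pi.sub_apply, Pi.smul_apply, smul_eq_mul, mul_sub, Finset.sum_sub_distrib]
    rw [h2, ← hS, sub_self]
  have hsplit : w = (w - (S * (ℓ i₀)⁻¹) • (Pi.single i₀ 1 : Fin 4 → K)) +
      (S * (ℓ i₀)⁻¹) • (Pi.single i₀ 1 : Fin 4 → K) := by
    rw [sub_add_cancel]
  conv_lhs => rw [hsplit]
  rw [map_add, map_smul, hker _ hw', zero_add, polarMap_single]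

/-! ## 3. Tame forms with a hyperplane polar kernel are powers of the linear form -/

/-- Positive naturals below `p` are invertible in characteristic `p`. [folklore] -/
theorem natCast_ne_zero_of_lt (p : ℕ) [Fact p.Prime] [CharP K p] {n : ℕ} (h0 : 0 < n) (hn : n < p) :
    (n : K) ≠ 0 := by
  intro h
  have hdvd := (CharP.cast_eq_zero_iff K p n).mp h
  exact absurd (Nat.le_of_dvd h0 hdvd) (by omega)

/-- **A form of degree `d < p` whose polar map kills a hyperplane `{Σ ℓᵢ wᵢ = 0}` (`ℓ ≠ 0`) is a scalar
multiple of `(Σ ℓᵢ xᵢ)^d`.**  Induction on `d` with Euler's identity; false for `d ≥ p` (`x^p + y^p`).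
[folklore] [cite: CossartJannsenSaito2020, Def. 2.8 (directrix of a cone)] -/
theorem eq_C_mul_pow_of_ker_le (p : ℕ) [Fact p.Prime] [CharP K p] {ℓ : Fin 4 → K} {i₀ : Fin 4}
    (hi : ℓ i₀ ≠ 0) :
    ∀ (d : ℕ), d < p → ∀ g : MvPolynomial (Fin 4) K, g.IsHomogeneous d →
      (∀ w : Fin 4 → K, ∑ i, ℓ i * w i = 0 → polarMap g w = 0) →
      ∃ c : K, g = C c * (∑ i, C (ℓ i) * X i) ^ d := by
  intro d
  induction d with
  | zero =>
    intro _ g hg _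
    refine ⟨coeff 0 g, ?_⟩
    rw [pow_zero, mul_one]
    exact totalDegree_eq_zero_iff_eq_C.mp ((totalDegree_zero_iff_isHomogeneous _).mpr hg)
  | succ d ih =>
    intro hdp g hg hker
    -- `h := ℓ_{i₀}⁻¹ • ∂_{i₀} g` is a form of degree `d` with the same kernel condition
    have hh : ((ℓ i₀)⁻¹ • pderiv i₀ g).IsHomogeneous d := by
      rw [← MvPolynomial.C_mul']
      simpa using (isHomogeneous_C (Fin 4) (ℓ i₀)⁻¹).mul (hg.pderiv (i := i₀))
    have hkerh : ∀ w : Fin 4 → K, ∑ i, ℓ i * w i = 0 → polarMap ((ℓ i₀)⁻¹ • pderiv i₀ g) w = 0 := by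
      intro w hw
      rw [polarMap_smul_form, polarMap_pderiv_comm, hker w hw, map_zero, smul_zero]
    obtain ⟨c, hc⟩ := ih (by omega) _ hh hkerh
    -- every partial is a multiple of `h`
    have hpd : ∀ i, pderiv i g = ℓ i • ((ℓ i₀)⁻¹ • pderiv i₀ g) := by
      intro i
      rw [← polarMap_single, polarMap_eq_smul_pderiv hi hker, smul_smul,
        Finset.sum_eq_single i (fun k _ hki => by rw [Pi.single_eq_of_ne hki, mul_zero])
          (fun h => absurd (Finset.mem_univ _) h), Pi.single_eq_same, mul_one]
    -- Euler: `(d + 1) • g = Σ xᵢ ∂ᵢ g = ℓ · h = c ℓ^{d+1}`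
    have heuler := hg.sum_X_mul_pderiv
    have hpd' : ∀ i, pderiv i g = ℓ i • (C c * (∑ i, C (ℓ i) * X i) ^ d) := by
      intro i; rw [hpd, hc]
    have hsum : ∑ i : Fin 4, X i * pderiv i g =
        C c * (∑ i, C (ℓ i) * X i) ^ (d + 1) := by
      simp_rw [hpd']
      rw [pow_succ, Finset.mul_sum, Finset.mul_sum]
      refine Finset.sum_congr rfl fun i _ => ?_
      rw [← MvPolynomial.C_mul']
      ring
    have hn : ((d + 1 : ℕ) : K) ≠ 0 := natCast_ne_zero_of_lt p (Nat.succ_pos d) hdp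
    refine ⟨((d + 1 : ℕ) : K)⁻¹ * c, ?_⟩
    rw [hsum, ← Nat.cast_smul_eq_nsmul K] at heuler
    rw [← inv_smul_smul₀ hn g, ← heuler, ← MvPolynomial.C_mul', map_mul, mul_assoc]

/-! ## 4. The `e_G = 3` slice of the residual cone -/

/-- A non-zero linear functional on `K⁴` has a three-dimensional kernel. [folklore] -/
theorem finrank_ker_eq_three {f : (Fin 4 → K) →ₗ[K] K} (hf : f ≠ 0) :
    Module.finrank K (LinearMap.ker f) = 3 := by
  have h := LinearMap.finrank_range_add_finrank_ker f
  rw [Module.finrank_fin_fun] at h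
  have h1 : Module.finrank K (LinearMap.range f) ≤ 1 := by
    have := Submodule.finrank_le (LinearMap.range f)
    rwa [Module.finrank_self] at this
  have h0 : Module.finrank K (LinearMap.range f) ≠ 0 := by
    rw [Ne, Submodule.finrank_eq_zero, LinearMap.range_eq_bot]
    exact hf
  omega

/-- **THE `e_G = 3` SLICE IS A POWER CONE** (tame range): for a state with `x^r ∣ F`, `ord₀ F = o`, shade
`d = o − |r| < p` and polar-kernel rank `3`, the residual cone is `c · ℓ^d` for a non-zero linear form `ℓ`
vanishing on `resVertex s`. [OURS] [cite: CossartJannsenSaito2020, Def. 2.8 (directrix of a cone)] -/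
theorem resForm_eq_C_mul_pow_of_finrank_eq_three (p : ℕ) [Fact p.Prime] [CharP K p] {s : State K}
    {o : ℕ} (ho : ordZero s.F = o) (hd : o - s.r.degree < p)
    (he : Module.finrank K (resVertex s) = 3) :
    ∃ (ℓ : Fin 4 → K) (c : K), ℓ ≠ 0 ∧ (∀ w, w ∈ resVertex s ↔ ∑ i, ℓ i * w i = 0) ∧
      resForm s = C c * (∑ i, C (ℓ i) * X i) ^ (o - s.r.degree) := by
  have hlt : resVertex s < ⊤ := by
    refine lt_of_le_of_ne le_top fun htop => ?_
    have h := he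
    rw [htop, finrank_top, Module.finrank_fin_fun] at h
    exact absurd h (by decide)
  obtain ⟨f, hf0, hle⟩ := Submodule.exists_le_ker_of_lt_top _ hlt
  -- the coefficients of `f`
  set ℓ : Fin 4 → K := fun i => f (fun j => if i = j then 1 else 0) with hℓ
  have hf : ∀ w : Fin 4 → K, f w = ∑ i, ℓ i * w i := by
    intro w
    rw [LinearMap.pi_apply_eq_sum_univ f w]
    exact Finset.sum_congr rfl fun i _ => by rw [smul_eq_mul, mul_comm]
  have hker : LinearMap.ker f = resVertex s :=
    (Submodule.eq_of_le_of_finrank_eq hle (by rw [he, finrank_ker_eq_three hf0])).symm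
  have hmem : ∀ w, w ∈ resVertex s ↔ ∑ i, ℓ i * w i = 0 := by
    intro w
    rw [← hker, LinearMap.mem_ker, hf]
  have hℓ0 : ℓ ≠ 0 := by
    intro h0
    apply hf0
    refine LinearMap.ext fun w => ?_
    rw [hf, LinearMap.zero_apply]
    exact Finset.sum_eq_zero fun i _ => by rw [h0, Pi.zero_apply, zero_mul]
  obtain ⟨i₀, hi₀⟩ : ∃ i₀, ℓ i₀ ≠ 0 := by
    by_contra h
    push Not at h
    exact hℓ0 (funext h)
  have hpol : ∀ w : Fin 4 → K, ∑ i, ℓ i * w i = 0 → polarMap (resForm s) w = 0 := by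
    intro w hw
    have hw' : w ∈ resVertex s := (hmem w).mpr hw
    unfold resVertex additiveSubspace at hw'
    exact LinearMap.mem_ker.mp hw'
  obtain ⟨c, hc⟩ := eq_C_mul_pow_of_ker_le p hi₀ _ hd _ (resForm_isHomogeneous ho) hpol
  exact ⟨ℓ, c, hℓ0, hmem, hc⟩

end ResCone

end Summit.ResolutionOfSingularities.ResolutionOfSingularities.Theorems.PIDim4

end
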